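import Literature.Barriers.AtomisticToContinuum.AnticontinuumLocalizationProductStructure
import Literature.Probability.Distributions.GaussianPoincare
import Literature.Probability.LatticeModels.WeaklyCoupledChainPartials
import HarnessLib

/-!
# Sections of phase-space observables and the Gaussian variance bound

`Literature/Barriers/AtomisticToContinuum/` — second support file for the discharge of
`DeRoeckHuveneers2015_decorrelation` (eq. (7.1) of De Roeck–Huveneers 2015). For an observable
`f(q, ω)` on the phase space of the rotor chain we consider its angle sections `q ↦ f(q, ω)`
(to which the configurational inequality `DeRoeckHuveneers2015_decorrelation_config` applies)
and its momentum average `F̄(ω) = ∫ f(q, ω) dν(q)` over the configurational Gibbs measure `ν`.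

* transfer of smoothness, periodicity, locality and partial derivatives to the sections
  (`contDiff_sectionQ`, `isConfigPeriodic_sectionQ`, `dependsOnlyNearConfig_sectionQ`,
  `partialConfig_sectionQ_sub_const`);
* `stronglyMeasurable_avgQ`, `avgQ_eq_of_eqOn` (measurability of `F̄` and its locality in `ω`),
  `memLp_two_avgQ` (`F̄ ∈ L²` of the momentum law when `f ∈ L²(⟨·⟩_T)`);
* `integral_sq_avgQ_le` — **the Gaussian variance bound**: if `∫ f d⟨·⟩_T = 0` then
  `∫ F̄² d𝒩(0,T)^{⊗N} ≤ (π²T/4) ∑_x ∫ (∂_{ω_x} f)² d⟨·⟩_T`, from two Jensen inequalities and the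
  Gaussian Poincaré inequality `Literature.Probability.Distributions.lintegral_sq_sub_le_pi_gaussianReal`
  applied to the momentum sections `ω ↦ f(q, ω)`.

All proved; no definitions.
-/

noncomputable section

open MeasureTheory ProbabilityTheory Function Set Filter
open scoped ENNReal NNReal ContDiff

namespace Literature.Barriers.AtomisticToContinuum.HeatConduction.RotorChain

open Literature.MathematicalPhysics.KineticTheory.HeatConduction
open Literature.Probability.Distributions Literature.Probability.LatticeModels

variable {N : ℕ}

/-- The configurational Gibbs measure is s-finite (a scalar multiple of a measure with density). [folklore] -/
theorem sFinite_configGibbs (N : ℕ) (β γ : ℝ) : SFinite (configGibbs N β γ) := by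
  unfold configGibbs; infer_instance

/-! ### Angle sections `q ↦ f(q, ω)` -/

/-- Angle sections of a `Cⁿ` observable are `Cⁿ`. [folklore] -/
theorem contDiff_sectionQ {n : WithTop ℕ∞} {f : PhaseSpace N → ℝ} (hf : ContDiff ℝ n f) (w : Fin N → ℝ) :
    ContDiff ℝ n fun q : Fin N → ℝ => f (q, w) :=
  hf.comp (contDiff_prodMk_left w)

/-- Momentum sections of a `Cⁿ` observable are `Cⁿ`. [folklore] -/
theorem contDiff_sectionP {n : WithTop ℕ∞} {f : PhaseSpace N → ℝ} (hf : ContDiff ℝ n f) (q : Fin N → ℝ) :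
    ContDiff ℝ n fun w : Fin N → ℝ => f (q, w) :=
  hf.comp (contDiff_prodMk_right q)

/-- Angle sections (shifted by a constant) of an angle-periodic observable are periodic. [folklore] -/
theorem isConfigPeriodic_sectionQ {f : PhaseSpace N → ℝ} (hf : IsAnglePeriodic N f) (w : Fin N → ℝ) (c : ℝ) :
    IsConfigPeriodic N fun q : Fin N → ℝ => f (q, w) - c :=
  fun q x => by simp only [hf (q, w) x]

/-- Angle sections (shifted by a constant) of a local observable are local with the same window. [folklore] -/
theorem dependsOnlyNearConfig_sectionQ {f : PhaseSpace N → ℝ} {a : Fin N} {R : ℝ}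
    (hf : DependsOnlyNear N a R f) (w : Fin N → ℝ) (c : ℝ) :
    DependsOnlyNearConfig N a R fun q : Fin N → ℝ => f (q, w) - c :=
  fun q q' h => by simp only [hf (q, w) (q', w) fun x hx => ⟨h x hx, rfl⟩]

/-- The configurational partial derivatives of a shifted angle section are the `∂_{q_x}` partial
derivatives of the observable. [folklore] -/
theorem partialConfig_sectionQ_sub_const (x : Fin N) (f : PhaseSpace N → ℝ) (w : Fin N → ℝ) (c : ℝ)
    (q : Fin N → ℝ) :
    partialConfig x (fun q : Fin N → ℝ => f (q, w) - c) q = partialQ x f (q, w) := by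
  rw [partialQ_eq_partialConfig]
  unfold partialConfig
  exact deriv_sub_const c

/-- `∂_{ω_x} f (q, ω)` is the derivative of the momentum section `ω ↦ f(q, ω)` in the
direction `e_x`. [folklore] -/
theorem partialP_eq_fderiv_sectionP {f : PhaseSpace N → ℝ} (hf : Differentiable ℝ f) (x : Fin N)
    (q w : Fin N → ℝ) :
    partialP x f (q, w) = fderiv ℝ (fun w : Fin N → ℝ => f (q, w)) w (Pi.single x 1) := by
  have hd : Differentiable ℝ fun w : Fin N → ℝ => f (q, w) :=
    hf.comp ((differentiable_const q).prodMk differentiable_id)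
  exact BoxChain.deriv_comp_update hd x w

/-! ### Momentum averages `F̄(ω) = ∫ f(q, ω) dν(q)` -/

/-- The momentum average of a continuous observable is (strongly) measurable. [folklore] -/
theorem stronglyMeasurable_avgQ (ν : Measure (Fin N → ℝ)) [SFinite ν] {f : PhaseSpace N → ℝ} (hf : Continuous f) :
    StronglyMeasurable fun w : Fin N → ℝ => ∫ q, f (q, w) ∂ν :=
  hf.stronglyMeasurable.integral_prod_left'

/-- The momentum average of a local observable depends only on the momenta in its window. [folklore] -/
theorem avgQ_eq_of_eqOn (ν : Measure (Fin N → ℝ)) {f : PhaseSpace N → ℝ} {a : Fin N} {R : ℝ}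
    (hf : DependsOnlyNear N a R f) {w w' : Fin N → ℝ} (h : ∀ x : Fin N, |(x.val : ℝ) - a.val| ≤ R → w x = w' x) :
    ∫ q, f (q, w) ∂ν = ∫ q, f (q, w') ∂ν := by
  congr 1
  funext q
  exact hf (q, w) (q, w') fun x hx => ⟨rfl, h x hx⟩

/-- Angle sections of a continuous observable are square integrable for the configurational
Gibbs measure. [folklore] -/
theorem memLp_two_sectionQ (β γ : ℝ) {f : PhaseSpace N → ℝ} (hf : Continuous f) (w : Fin N → ℝ) :
    MemLp (fun q : Fin N → ℝ => f (q, w)) 2 (configGibbs N β γ) :=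
  (memLp_two_iff_integrable_sq (hf.comp (Continuous.prodMk_left w)).aestronglyMeasurable).2
    (integrable_configGibbs_of_continuous β γ ((hf.comp (Continuous.prodMk_left w)).pow 2))

/-- **Jensen for the momentum average**: `F̄(ω)² ≤ ∫ f(q, ω)² dν(q)` (`β, γ ≥ 0`). [folklore] -/
theorem sq_avgQ_le {β γ : ℝ} (hβ : 0 ≤ β) (hγ : 0 ≤ γ) {f : PhaseSpace N → ℝ} (hf : Continuous f) (w : Fin N → ℝ) :
    (∫ q, f (q, w) ∂(configGibbs N β γ)) ^ 2 ≤ ∫ q, f (q, w) ^ 2 ∂(configGibbs N β γ) := by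
  haveI := isProbabilityMeasure_configGibbs (N := N) hβ hγ
  exact sq_integral_le_integral_sq (memLp_two_sectionQ β γ hf w)

/-- **`F̄ ∈ L²`** of the momentum law when `f ∈ L²` of the product state (Jensen + Tonelli). [folklore] -/
theorem memLp_two_avgQ {β γ : ℝ} (hβ : 0 ≤ β) (hγ : 0 ≤ γ) (G : Measure (Fin N → ℝ)) [SFinite G]
    {f : PhaseSpace N → ℝ} (hf : Continuous f) (hf2 : Integrable (fun z => f z ^ 2) ((configGibbs N β γ).prod G)) :
    MemLp (fun w : Fin N → ℝ => ∫ q, f (q, w) ∂(configGibbs N β γ)) 2 G := by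
  haveI := sFinite_configGibbs N β γ
  set ν := configGibbs N β γ with hν
  have hsm := stronglyMeasurable_avgQ ν hf
  refine (memLp_two_iff_integrable_sq hsm.aestronglyMeasurable).2 ?_
  refine (lintegral_ofReal_ne_top_iff_integrable (hsm.aestronglyMeasurable.pow 2)
    (ae_of_all _ fun w => sq_nonneg _)).1 (ne_of_lt ?_)
  have hf2c : Continuous fun z : PhaseSpace N => f z ^ 2 := hf.pow 2
  calc ∫⁻ w, ENNReal.ofReal ((∫ q, f (q, w) ∂ν) ^ 2) ∂G
      ≤ ∫⁻ w, ENNReal.ofReal (∫ q, f (q, w) ^ 2 ∂ν) ∂G :=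
        lintegral_mono fun w => ENNReal.ofReal_le_ofReal (sq_avgQ_le hβ hγ hf w)
    _ = ∫⁻ w, ∫⁻ q, ENNReal.ofReal (f (q, w) ^ 2) ∂ν ∂G := by
        refine lintegral_congr fun w => ?_
        exact ofReal_integral_eq_lintegral_ofReal
          (integrable_configGibbs_of_continuous β γ ((hf.comp (Continuous.prodMk_left w)).pow 2))
          (ae_of_all _ fun q => sq_nonneg _)
    _ = ∫⁻ z, ENNReal.ofReal (f z ^ 2) ∂(ν.prod G) :=
        (lintegral_prod_symm _ (hf2c.measurable.ennreal_ofReal).aemeasurable).symm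
    _ = ENNReal.ofReal (∫ z, f z ^ 2 ∂(ν.prod G)) :=
        (ofReal_integral_eq_lintegral_ofReal hf2 (ae_of_all _ fun z => sq_nonneg _)).symm
    _ < ⊤ := ENNReal.ofReal_lt_top

/-- The momentum average integrates to the phase-space average (Fubini). [folklore] -/
theorem integral_avgQ {β γ : ℝ} (G : Measure (Fin N → ℝ)) [SFinite G] {f : PhaseSpace N → ℝ}
    (hfi : Integrable f ((configGibbs N β γ).prod G)) :
    ∫ w, (∫ q, f (q, w) ∂(configGibbs N β γ)) ∂G = ∫ z, f z ∂((configGibbs N β γ).prod G) := by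
  haveI := sFinite_configGibbs N β γ
  exact (integral_prod_symm f hfi).symm

/-! ### The Gaussian variance bound -/

/-- **The Gaussian variance bound for momentum averages.** For `T > 0`, `β, γ ≥ 0`, a `C¹`
observable `f` on the phase space with `f ∈ L²`, `∂_{ω_x} f ∈ L²` and mean zero under
`μ = ν_{N,β,γ} ⊗ 𝒩(0,T)^{⊗N}`, the momentum average `F̄(ω) = ∫ f(q, ω) dν(q)` satisfies
`∫ F̄² d𝒩(0,T)^{⊗N} ≤ (π²T/4) ∑_x ∫ (∂_{ω_x} f)² dμ`: `F̄(ω)² ≤ ∫ (F̄(ω) - F̄(η))² dG(η)`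
(Jensen, mean zero), `(F̄(ω) - F̄(η))² ≤ ∫ (f(q,ω) - f(q,η))² dν(q)` (Jensen), Tonelli, and the
Gaussian Poincaré inequality for each momentum section `ω ↦ f(q, ω)`. [folklore] -/
theorem integral_sq_avgQ_le {T β γ : ℝ} (hT : 0 < T) (hβ : 0 ≤ β) (hγ : 0 ≤ γ) {f : PhaseSpace N → ℝ}
    (hf : ContDiff ℝ 1 f)
    (hf2 : Integrable (fun z => f z ^ 2)
      ((configGibbs N β γ).prod (Measure.pi fun _ : Fin N => gaussianReal 0 T.toNNReal)))
    (hP : ∀ x, Integrable (fun z => partialP x f z ^ 2)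
      ((configGibbs N β γ).prod (Measure.pi fun _ : Fin N => gaussianReal 0 T.toNNReal)))
    (hmean : ∫ z, f z ∂((configGibbs N β γ).prod (Measure.pi fun _ : Fin N => gaussianReal 0 T.toNNReal)) = 0) :
    ∫ w, (∫ q, f (q, w) ∂(configGibbs N β γ)) ^ 2 ∂(Measure.pi fun _ : Fin N => gaussianReal 0 T.toNNReal) ≤
      Real.pi ^ 2 / 4 * T * ∑ x, ∫ z, partialP x f z ^ 2
        ∂((configGibbs N β γ).prod (Measure.pi fun _ : Fin N => gaussianReal 0 T.toNNReal)) := by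
  haveI := sFinite_configGibbs N β γ
  set ν := configGibbs N β γ with hν
  set G : Measure (Fin N → ℝ) := Measure.pi fun _ : Fin N => gaussianReal 0 T.toNNReal with hG
  haveI : IsProbabilityMeasure ν := isProbabilityMeasure_configGibbs hβ hγ
  haveI : IsProbabilityMeasure G := by rw [hG]; infer_instance
  have hfc : Continuous f := hf.continuous
  have hfd : Differentiable ℝ f := hf.differentiable one_ne_zero
  have hcoe : ((T.toNNReal : ℝ≥0) : ℝ) = T := Real.coe_toNNReal T hT.le
  -- integrability of `f` itself
  have hfm2 : MemLp f 2 (ν.prod G) := (memLp_two_iff_integrable_sq hfc.aestronglyMeasurable).2 hf2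
  have hfi : Integrable f (ν.prod G) := hfm2.integrable one_le_two
  -- the momentum average and its basic properties
  set Fbar : (Fin N → ℝ) → ℝ := fun w => ∫ q, f (q, w) ∂ν with hFbar
  have hFm : MemLp Fbar 2 G := memLp_two_avgQ hβ hγ G hfc hf2
  have hFi : Integrable Fbar G := hFm.integrable one_le_two
  have hFmean : ∫ w, Fbar w ∂G = 0 := by rw [hFbar, integral_avgQ G hfi]; exact hmean
  -- sections are in `L²(ν)`
  have hsec : ∀ w, MemLp (fun q : Fin N → ℝ => f (q, w)) 2 ν := fun w => memLp_two_sectionQ β γ hfc w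
  have hseci : ∀ w, Integrable (fun q : Fin N → ℝ => f (q, w)) ν := fun w => (hsec w).integrable one_le_two
  -- (i) Jensen in `η`: `F̄(ω)² ≤ ∫ (F̄ ω - F̄ η)² dG(η)`
  have hJ1 : ∀ w, Fbar w ^ 2 ≤ ∫ η, (Fbar w - Fbar η) ^ 2 ∂G := by
    intro w
    have hmem : MemLp (fun η => Fbar w - Fbar η) 2 G := (memLp_const _).sub hFm
    have e : Fbar w = ∫ η, (Fbar w - Fbar η) ∂G := by
      rw [integral_sub (integrable_const _) hFi, hFmean, integral_const, sub_zero]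
      simp
    calc Fbar w ^ 2 = (∫ η, (Fbar w - Fbar η) ∂G) ^ 2 := by rw [← e]
      _ ≤ _ := sq_integral_le_integral_sq hmem
  -- (ii) Jensen in `q`: `(F̄ ω - F̄ η)² ≤ ∫ (f(q,ω) - f(q,η))² dν(q)`
  have hJ2 : ∀ w η, (Fbar w - Fbar η) ^ 2 ≤ ∫ q, (f (q, w) - f (q, η)) ^ 2 ∂ν := by
    intro w η
    have hmem : MemLp (fun q : Fin N → ℝ => f (q, w) - f (q, η)) 2 ν := (hsec w).sub (hsec η)
    have e : Fbar w - Fbar η = ∫ q, (f (q, w) - f (q, η)) ∂ν := by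
      rw [hFbar]
      exact (integral_sub (hseci w) (hseci η)).symm
    rw [e]
    exact sq_integral_le_integral_sq hmem
  -- the three-variable integrand
  have hKc : Continuous fun p : ((Fin N → ℝ) × (Fin N → ℝ)) × (Fin N → ℝ) =>
      (f (p.2, p.1.1) - f (p.2, p.1.2)) ^ 2 :=
    ((hfc.comp (by fun_prop)).sub (hfc.comp (by fun_prop))).pow 2
  -- (iii) the chain of `lintegral` inequalities
  have hdiff_int : ∀ w, Integrable (fun η => (Fbar w - Fbar η) ^ 2) G := fun w =>
    ((memLp_const _).sub hFm).integrable_sq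
  have hsecd_int : ∀ w η, Integrable (fun q : Fin N → ℝ => (f (q, w) - f (q, η)) ^ 2) ν := fun w η =>
    ((hsec w).sub (hsec η)).integrable_sq
  have h1 : ∫⁻ w, ENNReal.ofReal (Fbar w ^ 2) ∂G ≤
      ∫⁻ w, ∫⁻ η, ∫⁻ q, ENNReal.ofReal ((f (q, w) - f (q, η)) ^ 2) ∂ν ∂G ∂G := by
    refine lintegral_mono fun w => ?_
    calc ENNReal.ofReal (Fbar w ^ 2) ≤ ENNReal.ofReal (∫ η, (Fbar w - Fbar η) ^ 2 ∂G) :=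
          ENNReal.ofReal_le_ofReal (hJ1 w)
      _ = ∫⁻ η, ENNReal.ofReal ((Fbar w - Fbar η) ^ 2) ∂G :=
          ofReal_integral_eq_lintegral_ofReal (hdiff_int w) (ae_of_all _ fun η => sq_nonneg _)
      _ ≤ ∫⁻ η, ENNReal.ofReal (∫ q, (f (q, w) - f (q, η)) ^ 2 ∂ν) ∂G :=
          lintegral_mono fun η => ENNReal.ofReal_le_ofReal (hJ2 w η)
      _ = ∫⁻ η, ∫⁻ q, ENNReal.ofReal ((f (q, w) - f (q, η)) ^ 2) ∂ν ∂G :=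
          lintegral_congr fun η => ofReal_integral_eq_lintegral_ofReal (hsecd_int w η)
            (ae_of_all _ fun q => sq_nonneg _)
  -- (iv) Tonelli: move `q` outside
  have h2 : ∫⁻ w, ∫⁻ η, ∫⁻ q, ENNReal.ofReal ((f (q, w) - f (q, η)) ^ 2) ∂ν ∂G ∂G =
      ∫⁻ q, ∫⁻ w, ∫⁻ η, ENNReal.ofReal ((f (q, w) - f (q, η)) ^ 2) ∂G ∂G ∂ν := by
    have hin : ∀ w, ∫⁻ η, ∫⁻ q, ENNReal.ofReal ((f (q, w) - f (q, η)) ^ 2) ∂ν ∂G =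
        ∫⁻ q, ∫⁻ η, ENNReal.ofReal ((f (q, w) - f (q, η)) ^ 2) ∂G ∂ν := by
      intro w
      refine lintegral_lintegral_swap ?_
      have hc : Continuous fun p : (Fin N → ℝ) × (Fin N → ℝ) => (f (p.2, w) - f (p.2, p.1)) ^ 2 :=
        ((hfc.comp (by fun_prop)).sub (hfc.comp (by fun_prop))).pow 2
      exact (hc.measurable.ennreal_ofReal).aemeasurable
    simp_rw [hin]
    refine lintegral_lintegral_swap ?_
    -- measurability of `(ω, q) ↦ ∫⁻ η, …`
    have hm : Measurable fun p : ((Fin N → ℝ) × (Fin N → ℝ)) × (Fin N → ℝ) =>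
        ENNReal.ofReal ((f (p.1.2, p.1.1) - f (p.1.2, p.2)) ^ 2) :=
      (((hfc.comp (by fun_prop)).sub (hfc.comp (by fun_prop))).pow 2).measurable.ennreal_ofReal
    exact (hm.lintegral_prod_right').aemeasurable
  -- (v) the Gaussian Poincaré inequality for each momentum section
  have h3 : ∀ q, ∫⁻ w, ∫⁻ η, ENNReal.ofReal ((f (q, w) - f (q, η)) ^ 2) ∂G ∂G ≤
      ENNReal.ofReal (Real.pi ^ 2 / 4 * T) * ∫⁻ w, ENNReal.ofReal (∑ x, partialP x f (q, w) ^ 2) ∂G := by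
    intro q
    have hGP := lintegral_sq_sub_le_pi_gaussianReal (n := N) T.toNNReal (contDiff_sectionP hf q)
    rw [hcoe] at hGP
    refine hGP.trans (le_of_eq ?_)
    congr 1
    refine lintegral_congr fun w => ?_
    congr 1
    exact Finset.sum_congr rfl fun x _ => by rw [partialP_eq_fderiv_sectionP hfd x q w]
  -- (vi) back to the product measure
  have hPc : Continuous fun z : PhaseSpace N => ∑ x, partialP x f z ^ 2 :=
    continuous_finsetSum _ fun x _ => (continuous_partialP hf one_ne_zero x).pow 2
  have hPi : Integrable (fun z : PhaseSpace N => ∑ x, partialP x f z ^ 2) (ν.prod G) :=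
    integrable_finsetSum _ fun x _ => hP x
  have h4 : ∫⁻ q, ∫⁻ w, ENNReal.ofReal (∑ x, partialP x f (q, w) ^ 2) ∂G ∂ν =
      ENNReal.ofReal (∑ x, ∫ z, partialP x f z ^ 2 ∂(ν.prod G)) := by
    rw [← lintegral_prod _ (hPc.measurable.ennreal_ofReal).aemeasurable,
      ← ofReal_integral_eq_lintegral_ofReal hPi (ae_of_all _ fun z => Finset.sum_nonneg fun x _ => sq_nonneg _),
      integral_finsetSum _ fun x _ => hP x]
  -- (vii) assemble in `ℝ≥0∞` and come back to `ℝ`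
  have hkey : ENNReal.ofReal (∫ w, Fbar w ^ 2 ∂G) ≤
      ENNReal.ofReal (Real.pi ^ 2 / 4 * T * ∑ x, ∫ z, partialP x f z ^ 2 ∂(ν.prod G)) := by
    rw [ofReal_integral_eq_lintegral_ofReal hFm.integrable_sq (ae_of_all _ fun w => sq_nonneg _)]
    calc ∫⁻ w, ENNReal.ofReal (Fbar w ^ 2) ∂G
        ≤ ∫⁻ q, ∫⁻ w, ∫⁻ η, ENNReal.ofReal ((f (q, w) - f (q, η)) ^ 2) ∂G ∂G ∂ν := h1.trans (le_of_eq h2)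
      _ ≤ ∫⁻ q, ENNReal.ofReal (Real.pi ^ 2 / 4 * T) *
            ∫⁻ w, ENNReal.ofReal (∑ x, partialP x f (q, w) ^ 2) ∂G ∂ν := lintegral_mono fun q => h3 q
      _ = ENNReal.ofReal (Real.pi ^ 2 / 4 * T) * ∫⁻ q, ∫⁻ w, ENNReal.ofReal (∑ x, partialP x f (q, w) ^ 2) ∂G ∂ν := by
          rw [lintegral_const_mul]
          exact (hPc.measurable.ennreal_ofReal).lintegral_prod_right'
      _ = ENNReal.ofReal (Real.pi ^ 2 / 4 * T * ∑ x, ∫ z, partialP x f z ^ 2 ∂(ν.prod G)) := by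
          rw [h4, ← ENNReal.ofReal_mul (by positivity)]
  have hR0 : 0 ≤ Real.pi ^ 2 / 4 * T * ∑ x, ∫ z, partialP x f z ^ 2 ∂(ν.prod G) :=
    mul_nonneg (by positivity) (Finset.sum_nonneg fun x _ => integral_nonneg fun z => sq_nonneg _)
  exact (ENNReal.ofReal_le_ofReal_iff hR0).1 hkey

end Literature.Barriers.AtomisticToContinuum.HeatConduction.RotorChain

end
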